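import Summits.QuantumFields.BalabanUV.T4Continuum.Support.NE7FlatInteriorGradientModulusVec
import HarnessLib

/-!
# NE7Reg10ImpliesReg9 — IN THE CURRENCY OF [Balaban1985Variational] Thm 1: THE FIRST CLAUSE OF (9) (`|A| ≲ ε`) AND THE LAPLACIAN CLAUSE OF (10) (`|Δ^ηA| ≲ ε`,
# LOG-FREE) ON A CUBE IMPLY THE GRADIENT CLAUSE OF (9) (`|∇^ηA| ≲ ε`) AND THE HÖLDER CLAUSE OF (9) FOR EVERY `β < 1` OVER THE FULL PHYSICAL RANGE — with constants
# INDEPENDENT OF THE LATTICE SPACING `η = 1∕m` (file F4 of gen 112's line «flat interior C^{1,log-Lip} potential theory + (10) ⟹ (9)_{β<1}»)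

Cell `pub-balaban`, rung (B)+1 sub-cell t4, lineage `b2b-balaban-t4-ne7-p1` (CRUX PROVER NE7 #1 = OWNER of BINDER row NE7), generation 112.  Memo
`t4/b2b-balaban-t4-ne7-p1-g112/ROAD-G112.md` §2.  Over F3 `NE7FlatInteriorGradientModulusVec` (F1∕F2 underneath).
THE DICTIONARY (lattice units, as in the row's `TermwiseHolder.HolderReg` letters of gen 111): `m` lattice sites per physical unit (`η = 1∕m`; at level `k`, `m = L^k`), the
lattice-unit bond potential `B = ηA : ℤ^d → (Fin d → E)` (`E` any real normed space; `M_n(ℂ)` for `U(n)` fields), lattice differences.  Print's top-scale clauses (p. 279,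
`L^jη = 1`) read: (9)₁ `|A| ≲ ε` ⟺ `‖B‖ ≤ c₀ε∕m`; (9)₂ `|∇^ηA| ≲ ε` ⟺ `‖∇B‖ ≲ ε∕m²`; (9)₃ `‖A‖_{1,β} ≲ ε` ⟺ `‖∇B(z) − ∇B(z′)‖ ≲ ε·h^β∕m^{2+β}` at lattice separation
`h = |z − z′|_∞` (physical separation `h∕m ≤ O(1)`); (10) `|Δ^ηA| ≲ ε` ⟺ `‖Δ_lattice B‖ ≤ c_Δ·ε∕m³` (componentwise flat Laplacian in the bond direction).
THE THEOREM (**`reg9_of_reg10`**, every `d ≥ 3`, every real normed space `E`, `∃ C = C(d) ≥ 0`): for `m ≥ 1`, if `‖B(y,κ)‖ ≤ c₀ε∕m` and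
`‖Σ_μ[(B(y+e_μ,κ) − B(y,κ)) − (B(y,κ) − B(y−e_μ,κ))]‖ ≤ c_Δ·ε∕m³` for `y ∈ cube x (7m)`, then (i) `‖B(y+e_j,κ) − B(y,κ)‖ ≤ C·(c₀ + c_Δ)·ε∕m²` on `cube x (3m+1)`;
(ii) for every `β ∈ [0,1)` and all `z, z′ ∈ cube x (m−1)` (separations up to `2m − 2`, i.e. the FULL physical range `≈ 2`):
`‖(B(z+e_μ,κ) − B(z,κ)) − (B(z′+e_μ,κ) − B(z′,κ))‖ ≤ C·(1 + (1−β)⁻¹)·(c₀ + c_Δ)·ε·h^β∕m^{2+β}`.  The constant does NOT depend on `m`: at `m = L^k` this is `k`-UNIFORM.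
READING FOR ROW NE7 (ROAD-G110 §4, ROAD-G111 §3–§4, ✓ p815039).  The junction logarithm `(1+k)` lives in the SECOND differences of the potential (sharp in kind, kit j342950) and
forbids `β = 1`; it does NOT enter (9) below `β = 1`: the log-Lipschitz modulus `h·log(m∕h)` is `≤ C_β·m^{1−β}h^β`.  Hence, for the constrained minimisers, print's (9) at every
`β < 1` over the physical unit box REDUCES to a gauge on that box with (9)₁ and a LOG-FREE (10) — the Landau-gauge crux of ROAD-G112 §3; the tree has such letters only on
l¹-balls of FIXED lattice radius (gen 111's axial gauge, ✓ p814290∕p815039), where this file adds nothing.  NOTHING is instantiated here for minimisers.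
WHAT ([folklore]; 0 def, 0 sorry).  `rpow_scaling` (`(ε∕m³)·(3m)^{1−β} ≤ 3·ε∕m^{2+β}`), **`reg9_of_reg10`**, and the `d = 4`, `E = M_n(ℂ)` instance as an `example`.
HONEST FRAMING (page 1): flat `ℤ^d` potential theory in print's scaling; a STRUCTURAL implication between the typed shapes of (9) and (10), not Bałaban's proof of either;
nothing of Bałaban's asserted; nothing about minimisers; NOT NE3∕NE7 as spine nodes; spine 0∕9; finite T⁴ rung (B)+1 — NOT infinite volume, NOT mass gap, NOT BetaPertH, NOT
Clay (continuum YM on T⁴ ⇐ BetaPertH ∧ nine spine estimates).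
-/

set_option autoImplicit false

open scoped BigOperators
open Finset

namespace Summit.QuantumFields.BalabanUV.T4Continuum.NE7Reg10ImpliesReg9

open Literature.MathematicalPhysics.QuantumFieldTheory.Balaban1983to89
open B7Prop1Explicit (Site e)
open Beta.PoissonInterior (cube mem_cube supNorm)
open NE7FlatInteriorGradientModulusVec (interior_gradient_sup_vec interior_gradient_holder_vec)

noncomputable section

variable {d : ℕ} {E : Type*} [NormedAddCommGroup E] [NormedSpace ℝ E]

/-! ## §1 The scaling arithmetic -/

omit [NormedAddCommGroup E] [NormedSpace ℝ E] in
/-- `(3m)^{1−β}∕m³ ≤ 3∕m^{2+β}` for `m ≥ 1`, `0 ≤ β` (`3^{1−β} ≤ 3`, `m^{1−β}∕m³ = m^{−(2+β)}`). [folklore] -/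
theorem rpow_scaling {m : ℕ} (hm : 1 ≤ m) {β : ℝ} (hβ0 : 0 ≤ β) :
    (3 * m : ℝ) ^ (1 - β) / (m : ℝ) ^ 3 ≤ 3 / (m : ℝ) ^ (2 + β) := by
  have hm0 : (0 : ℝ) < m := by exact_mod_cast hm
  have h3 : (3 : ℝ) ^ (1 - β) ≤ 3 := by
    calc (3 : ℝ) ^ (1 - β) ≤ (3 : ℝ) ^ (1 : ℝ) := Real.rpow_le_rpow_of_exponent_le (by norm_num) (by linarith)
      _ = 3 := Real.rpow_one 3
  have hsplit : (3 * m : ℝ) ^ (1 - β) = (3 : ℝ) ^ (1 - β) * (m : ℝ) ^ (1 - β) := Real.mul_rpow (by norm_num) hm0.le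
  have hm3 : (m : ℝ) ^ (1 - β) / (m : ℝ) ^ 3 = 1 / (m : ℝ) ^ (2 + β) := by
    rw [← Real.rpow_natCast (m : ℝ) 3, ← Real.rpow_sub hm0]
    push_cast
    rw [show (1 - β - 3 : ℝ) = -(2 + β) by ring, Real.rpow_neg hm0.le, one_div]
  have hmpos : 0 < (m : ℝ) ^ (1 - β) / (m : ℝ) ^ 3 := by positivity
  calc (3 * m : ℝ) ^ (1 - β) / (m : ℝ) ^ 3 = (3 : ℝ) ^ (1 - β) * ((m : ℝ) ^ (1 - β) / (m : ℝ) ^ 3) := by rw [hsplit]; ring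
    _ ≤ 3 * ((m : ℝ) ^ (1 - β) / (m : ℝ) ^ 3) := mul_le_mul_of_nonneg_right h3 hmpos.le
    _ = 3 / (m : ℝ) ^ (2 + β) := by rw [hm3]; ring

/-! ## §2 (9)₁ ∧ (10) ⟹ (9)₂ ∧ (9)₃ for every `β < 1`, uniformly in the spacing -/

/-- **(9)₁ ∧ (10) ⟹ (9)₂ ∧ (9)₃^{β<1}, UNIFORMLY IN `m`** (`d ≥ 3`, any real normed space `E`): `∃ C = C(d) ≥ 0` such that for every `m ≥ 1`, every bond potential
`B : ℤ^d → Fin d → E`, every centre `x` and all `ε, c₀, c_Δ ≥ 0`: if `‖B(y,κ)‖ ≤ c₀ε∕m` ((9)₁) and `‖Σ_μ[(B(y+e_μ,κ) − B(y,κ)) − (B(y,κ) − B(y−e_μ,κ))]‖ ≤ c_Δ·ε∕m³`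
((10), log-free) for all `y ∈ cube x (7m)` and all `κ`, then
(i) (9)₂: `‖B(y+e_j,κ) − B(y,κ)‖ ≤ C·(c₀ + c_Δ)·ε∕m²` for `y ∈ cube x (3m+1)`;
(ii) (9)₃: for `0 ≤ β < 1`, `z, z′ ∈ cube x (m−1)`, `h := |z − z′|_∞`: `‖(B(z+e_μ,κ) − B(z,κ)) − (B(z′+e_μ,κ) − B(z′,κ))‖ ≤ C·(1 + (1−β)⁻¹)·(c₀ + c_Δ)·ε·h^β∕m^{2+β}`.
[folklore] -/
theorem reg9_of_reg10 (hd : 3 ≤ d) : ∃ C : ℝ, 0 ≤ C ∧ ∀ (m : ℕ), 1 ≤ m →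
    ∀ (B : Site d → Fin d → E) (x : Site d) (ε c₀ cΔ : ℝ), 0 ≤ ε → 0 ≤ c₀ → 0 ≤ cΔ →
    (∀ y ∈ cube x (7 * m), ∀ κ : Fin d, ‖B y κ‖ ≤ c₀ * ε / m) →
    (∀ y ∈ cube x (7 * m), ∀ κ : Fin d, ‖∑ μ : Fin d, ((B (y + e μ) κ - B y κ) - (B y κ - B (y - e μ) κ))‖ ≤ cΔ * ε / (m : ℝ) ^ 3) →
    (∀ y ∈ cube x (3 * m + 1), ∀ j κ : Fin d, ‖B (y + e j) κ - B y κ‖ ≤ C * (c₀ + cΔ) * ε / (m : ℝ) ^ 2) ∧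
    (∀ (β : ℝ), 0 ≤ β → β < 1 → ∀ (z z' : Site d), z ∈ cube x (m - 1) → z' ∈ cube x (m - 1) → ∀ μ κ : Fin d,
      ‖(B (z + e μ) κ - B z κ) - (B (z' + e μ) κ - B z' κ)‖
        ≤ C * (1 + (1 - β)⁻¹) * (c₀ + cΔ) * ε * (supNorm (z - z') : ℝ) ^ β / (m : ℝ) ^ (2 + β)) := by
  obtain ⟨C₁, hC₁, hsup⟩ := interior_gradient_sup_vec (d := d) (E := E) hd
  obtain ⟨C₃, hC₃, hhol⟩ := interior_gradient_holder_vec (d := d) (E := E) hd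
  refine ⟨max C₁ (3 * C₃), le_max_of_le_left hC₁, fun m hm B x ε c₀ cΔ hε hc₀ hcΔ h9 h10 => ?_⟩
  have hm0 : (0 : ℝ) < m := by exact_mod_cast hm
  have hCle1 : C₁ ≤ max C₁ (3 * C₃) := le_max_left _ _
  have hCle3 : 3 * C₃ ≤ max C₁ (3 * C₃) := le_max_right _ _
  -- the scalar data of one bond direction `κ`: `A = c_Δ ε / m³`, `S = c₀ ε / m`
  have hAS : ∀ κ : Fin d, (∀ y ∈ cube x (7 * m), ‖∑ μ : Fin d, (((fun w => B w κ) (y + e μ) - (fun w => B w κ) y) -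
      ((fun w => B w κ) y - (fun w => B w κ) (y - e μ)))‖ ≤ cΔ * ε / (m : ℝ) ^ 3) ∧
      (∀ y ∈ cube x (7 * m), ‖(fun w => B w κ) y‖ ≤ c₀ * ε / m) := fun κ => ⟨fun y hy => h10 y hy κ, fun y hy => h9 y hy κ⟩
  constructor
  · intro y hy j κ
    have key := hsup m hm (fun w => B w κ) x _ _ (hAS κ).1 (hAS κ).2 y hy j
    have e1 : (m : ℝ) * (cΔ * ε / (m : ℝ) ^ 3) + c₀ * ε / m / m = (c₀ + cΔ) * ε / (m : ℝ) ^ 2 := by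
      field_simp
      ring
    calc ‖B (y + e j) κ - B y κ‖ ≤ C₁ * ((m : ℝ) * (cΔ * ε / (m : ℝ) ^ 3) + c₀ * ε / m / m) := key
      _ = C₁ * ((c₀ + cΔ) * ε / (m : ℝ) ^ 2) := by rw [e1]
      _ ≤ max C₁ (3 * C₃) * ((c₀ + cΔ) * ε / (m : ℝ) ^ 2) := mul_le_mul_of_nonneg_right hCle1 (by positivity)
      _ = _ := by ring
  · intro β hβ0 hβ1 z z' hz hz' μ κ
    have key := hhol m hm (fun w => B w κ) x _ _ (hAS κ).1 (hAS κ).2 β hβ0 hβ1 z z' hz hz' μ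
    have e1 : cΔ * ε / (m : ℝ) ^ 3 + c₀ * ε / m / (m : ℝ) ^ 2 = (c₀ + cΔ) * ε / (m : ℝ) ^ 3 := by
      field_simp
      ring
    rw [e1] at key
    have hε' : 0 < 1 - β := by linarith
    have hb : (0 : ℝ) ≤ 1 + (1 - β)⁻¹ := by positivity
    have hh : (0 : ℝ) ≤ (supNorm (z - z') : ℝ) ^ β := Real.rpow_nonneg (by positivity) _
    have hsc := rpow_scaling hm hβ0
    calc ‖(B (z + e μ) κ - B z κ) - (B (z' + e μ) κ - B z' κ)‖
        ≤ C₃ * (1 + (1 - β)⁻¹) * ((c₀ + cΔ) * ε / (m : ℝ) ^ 3) * (3 * m : ℝ) ^ (1 - β) * (supNorm (z - z') : ℝ) ^ β := key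
      _ = C₃ * (1 + (1 - β)⁻¹) * ((c₀ + cΔ) * ε) * ((3 * m : ℝ) ^ (1 - β) / (m : ℝ) ^ 3) * (supNorm (z - z') : ℝ) ^ β := by ring
      _ ≤ C₃ * (1 + (1 - β)⁻¹) * ((c₀ + cΔ) * ε) * (3 / (m : ℝ) ^ (2 + β)) * (supNorm (z - z') : ℝ) ^ β := by
          apply mul_le_mul_of_nonneg_right _ hh
          exact mul_le_mul_of_nonneg_left hsc (by positivity)
      _ = 3 * C₃ * (1 + (1 - β)⁻¹) * (c₀ + cΔ) * ε * (supNorm (z - z') : ℝ) ^ β / (m : ℝ) ^ (2 + β) := by ring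
      _ ≤ _ := by
          have hmβ : 0 < (m : ℝ) ^ (2 + β) := Real.rpow_pos_of_pos hm0 _
          apply div_le_div_of_nonneg_right _ hmβ.le
          have : 0 ≤ (1 + (1 - β)⁻¹) * (c₀ + cΔ) * ε * (supNorm (z - z') : ℝ) ^ β := by positivity
          nlinarith

/-! ## §3 Non-vacuity: the cell's case `d = 4`, `E = M_n(ℂ)` (the `U(n)` bond potentials of row NE7, `L²`-operator norm, real structure by restriction of scalars) -/

section MatrixInstance

open scoped Matrix.Norms.L2Operator

/-- The cell's instance: `d = 4`, matrix-valued bond potentials with the `L²`-operator norm. [folklore] -/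
example {n : Type*} [Fintype n] [DecidableEq n] :
    ∃ C : ℝ, 0 ≤ C ∧ ∀ (m : ℕ), 1 ≤ m →
    ∀ (B : Site 4 → Fin 4 → Matrix n n ℂ) (x : Site 4) (ε c₀ cΔ : ℝ), 0 ≤ ε → 0 ≤ c₀ → 0 ≤ cΔ →
    (∀ y ∈ cube x (7 * m), ∀ κ : Fin 4, ‖B y κ‖ ≤ c₀ * ε / m) →
    (∀ y ∈ cube x (7 * m), ∀ κ : Fin 4, ‖∑ μ : Fin 4, ((B (y + e μ) κ - B y κ) - (B y κ - B (y - e μ) κ))‖ ≤ cΔ * ε / (m : ℝ) ^ 3) →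
    (∀ y ∈ cube x (3 * m + 1), ∀ j κ : Fin 4, ‖B (y + e j) κ - B y κ‖ ≤ C * (c₀ + cΔ) * ε / (m : ℝ) ^ 2) ∧
    (∀ (β : ℝ), 0 ≤ β → β < 1 → ∀ (z z' : Site 4), z ∈ cube x (m - 1) → z' ∈ cube x (m - 1) → ∀ μ κ : Fin 4,
      ‖(B (z + e μ) κ - B z κ) - (B (z' + e μ) κ - B z' κ)‖
        ≤ C * (1 + (1 - β)⁻¹) * (c₀ + cΔ) * ε * (supNorm (z - z') : ℝ) ^ β / (m : ℝ) ^ (2 + β)) :=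
  reg9_of_reg10 (d := 4) (E := Matrix n n ℂ) (by norm_num)

end MatrixInstance

end

end Summit.QuantumFields.BalabanUV.T4Continuum.NE7Reg10ImpliesReg9
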